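import Literature.Topology.FourManifolds.BordismFourOrientableClasses
import Literature.Topology.FourManifolds.BordismFourRealProjectiveFour
import Literature.AlgebraicTopology.SingularHomology.DisjointUnion
import Literature.AlgebraicTopology.SingularHomology.CompactManifoldFiniteness
import HarnessLib

/-!
# Thom's invariant `(χ mod 2, v₁⁴) : 𝔑₄ → (ℤ/2)²` is a homomorphism; `|𝔑₄| = 4` from its kernel

R. Thom, *Quelques propriétés globales des variétés différentiables*, Comment. Math. Helv. 28
(1954), Thm IV.10 (p. 77): "Si une variété `Vᵏ` a tous ses nombres caractéristiques de
Stiefel–Whitney nuls, c'est une variété-bord (mod 2)", with Cor. IV.11 (equal numbers ⟹ cobordant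
mod 2) and, at `k = 4`, Thm IV.12 with pp. 79–80 (`𝔑⁴ ≅ ℤ₂ + ℤ₂`, numbers `w₄ = χ mod 2` and
`w₁⁴`).  The tree proves `|𝔑₄| = 4` from the injectivity of
`UnorientedBordismClass.thomInvariant = (χ mod 2, v₁⁴[·])`
(`natCard_unorientedBordismClass_four_of_injective`, `BordismFourRealProjectiveFour.lean`).  This
file turns that remaining hypothesis into the LITERAL form of Thm IV.10 at `k = 4` and splits it
along the orientable/non-orientable dichotomy:

* §1 `ClosedSingularManifold.intEulerChar_sum` — **`χ(M ⊔ N) = χ(M) + χ(N)`** (additivity of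
  singular homology, Hatcher Prop. 2.6, the tree's `singularHomology.sumEquiv`; ranks read over
  `ℚ`, `bettiNumber_int_eq_rat`, where `H_•` of a compact manifold is finite-dimensional,
  `finite_singularHomology_of_compactSpace_holds`), hence
  `UnorientedBordismClass.eulerCharModTwo_add` and **`thomInvariant_add`: Thom's invariant is
  additive on `𝔑₄`** (Thom 1954, Ch. IV §1–§2: characteristic numbers are additive under `⊔`);
* §2 `UnorientedBordismClass.injective_thomInvariant_iff` — in the elementary abelian 2-group
  `𝔑₄` (`a + a = 0`, `bordismFacts_succ`) injectivity of an additive map is triviality of its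
  kernel; `UnorientedBordismClass.mk_carrier` (`[M] = [(M, const)]` for a closed singular manifold
  over the point);
* §3 **`natCard_unorientedBordismClass_four_of_forall_mk_eq_zero`** — `|𝔑₄| = 4` follows from:
  *every closed smooth 4-manifold `M` with `χ(M)` even and `v₁⁴[M] = 0` bounds mod 2* — Thom's
  Thm IV.10 at `k = 4` as printed (by Wu's formula `w₁ = v₁`, `w₄[M] = χ(M) mod 2`, and the
  relations `w₂² = w₄ + w₁⁴`, `w₁²w₂ = w₁w₃ = 0` on closed 4-manifolds, the vanishing of all
  Stiefel–Whitney numbers of `M⁴` is the vanishing of these two); this hypothesis is a plain binder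
  (nothing is asserted) — it is the Pontryagin–Thom computation (Thm II.10 + Thm IV.8), not in the
  tree;
* §5 `natCard_unorientedBordismClass_four_iff_injective_thomInvariant`,
  `natCard_unorientedBordismClass_four_iff_forall_mk_eq_zero` — **both reductions are lossless**:
  `|𝔑₄| = 4` ↔ `thomInvariant` injective ↔ Thm IV.10 at `k = 4` (four elements are exhausted by
  the tree's pairwise distinct `0, [ℂℙ²], [ℝℙ⁴], [ℂℙ²] + [ℝℙ⁴]`, on which the kernel is trivial);
* §4 **`natCard_unorientedBordismClass_four_of_thom_of_exists_orientable`** — the same from TWO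
  inputs: Thom's Thm IV.13 on `Ω⁴` (the tree's open named fact
  `isOrientedBordant_of_signature_eq`, which settles the orientable classes,
  `BordismFourOrientableClasses.lean`) and the statement that *a closed smooth 4-manifold with
  `v₁⁴[M] = 0` is bordant mod 2 to an orientable one* (Thm IV.12 at `k = 4`: the classes with
  `w₁⁴ = 0` are `0` and `[PC(2)]`; C. T. C. Wall, *Determination of the cobordism ring*, Ann. of
  Math. 72 (1960): the image of `Ω → 𝔑`), again a plain binder.

Everything here is proved; no definitions, no named facts (D-0026); written in support of
`Literature.Topology.FourManifolds.natCard_unorientedBordismClass_four`.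

## References

* R. Thom, *Quelques propriétés globales des variétés différentiables*, Comment. Math. Helv. 28
  (1954), 17–86: Ch. IV §1–§2 (pp. 64–65), Thm IV.10, Cor. IV.11 (p. 77), Thm IV.12 and
  pp. 79–80, Thm IV.13 (p. 81). [ThomCMH1954]
* C. T. C. Wall, *Determination of the cobordism ring*, Ann. of Math. 72 (1960), 292–311. [Wall1960]
* J. W. Milnor, J. D. Stasheff, *Characteristic Classes* (1974), §4 (Stiefel–Whitney numbers,
  Thm. 4.9–4.10, Cor. 11.12), §17. [MilnorStasheff1974]
* A. Hatcher, *Algebraic Topology* (2002), Prop. 2.6, §3.A Cor. 3A.6. [HatcherAT2002]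
-/

noncomputable section

open scoped Manifold ContDiff
open CategoryTheory Set Function
open Literature.AlgebraicTopology.SingularHomology

namespace Literature.Topology.FourManifolds

universe u

/-! ### §1 `χ` is additive under disjoint union; Thom's invariant is a homomorphism -/

section Euler

variable {n : ℕ}

/-- **`b_i(X ⊔ Y) = b_i(X) + b_i(Y)`** for the ranks of `H_i(−; ℤ)` of compact manifolds
(Hatcher 2002, Prop. 2.6: `H_i(X ⊔ Y) ≅ H_i(X) ⊕ H_i(Y)`, the tree's `singularHomology.sumEquiv`;
ranks computed over `ℚ`, Cor. 3A.6, where the homology of a compact manifold is finite-dimensional).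
[cite: HatcherAT2002, Prop. 2.6 and §3.A Cor. 3A.6] -/
theorem finrank_singularHomology_sum (X Y : Type u) [TopologicalSpace X] [T2Space X] [CompactSpace X]
    [ChartedSpace (EuclideanSpace ℝ (Fin n)) X] [TopologicalSpace Y] [T2Space Y] [CompactSpace Y]
    [ChartedSpace (EuclideanSpace ℝ (Fin n)) Y] (i : ℕ) :
    Module.finrank ℤ (singularHomology ℤ ℤ (X ⊕ Y) i) =
      Module.finrank ℤ (singularHomology ℤ ℤ X i) + Module.finrank ℤ (singularHomology ℤ ℤ Y i) := by
  have hX : Module.Finite ℚ (singularHomology ℚ ℚ X i) :=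
    finite_singularHomology_of_compactSpace_holds ℚ X n i
  have hY : Module.Finite ℚ (singularHomology ℚ ℚ Y i) :=
    finite_singularHomology_of_compactSpace_holds ℚ Y n i
  change bettiNumber ℤ (X ⊕ Y) i = bettiNumber ℤ X i + bettiNumber ℤ Y i
  rw [bettiNumber_int_eq_rat, bettiNumber_int_eq_rat, bettiNumber_int_eq_rat]
  unfold bettiNumber
  rw [← LinearEquiv.finrank_eq (singularHomology.sumEquiv ℚ ℚ X Y i), Module.finrank_prod]

/-- **`χ(M ⊔ N) = χ(M) + χ(N)`** for closed singular `n`-manifolds (Thom 1954, Ch. IV §1–§2;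
Milnor–Stasheff 1974, §4: characteristic numbers, here `w_n = χ mod 2`, are additive under `⊔`).
[cite: ThomCMH1954, Ch. IV §1–§2 (pp. 64–65)] [cite: HatcherAT2002, Prop. 2.6] -/
theorem ClosedSingularManifold.intEulerChar_sum {Y : Type*} [TopologicalSpace Y]
    (s t : ClosedSingularManifold.{u} Y n) :
    (s.sum t).intEulerChar = s.intEulerChar + t.intEulerChar := by
  unfold ClosedSingularManifold.intEulerChar
  rw [← Finset.sum_add_distrib]
  refine Finset.sum_congr rfl fun i _ => ?_
  have h : Module.finrank ℤ (singularHomology ℤ ℤ (s.sum t).M i) =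
      Module.finrank ℤ (singularHomology ℤ ℤ s.M i) + Module.finrank ℤ (singularHomology ℤ ℤ t.M i) :=
    finrank_singularHomology_sum (n := n) s.M t.M i
  rw [h]
  push_cast
  ring

/-- **`χ mod 2` is additive on `𝔑ₙ`**: `χ₂(a + b) = χ₂(a) + χ₂(b)` (addition is disjoint union of
representatives). [cite: ThomCMH1954, Ch. IV §1–§2 (pp. 64–65)] -/
theorem UnorientedBordismClass.eulerCharModTwo_add [ClosedSingularManifold.BordismFacts.{u} PUnit.{u + 1} n]
    (a b : UnorientedBordismClass.{u} n) :
    UnorientedBordismClass.eulerCharModTwo (a + b) =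
      UnorientedBordismClass.eulerCharModTwo a + UnorientedBordismClass.eulerCharModTwo b := by
  induction a using BordismClass.ind with | h s => ?_
  induction b using BordismClass.ind with | h t => ?_
  rw [BordismClass.mk_add_mk, UnorientedBordismClass.eulerCharModTwo_mk,
    UnorientedBordismClass.eulerCharModTwo_mk, UnorientedBordismClass.eulerCharModTwo_mk,
    ClosedSingularManifold.intEulerChar_sum, Int.cast_add]

end Euler

/-- **Thom's invariant `(χ mod 2, v₁⁴) : 𝔑₄ → (ℤ/2)²` is additive** (Thom 1954, Ch. IV §1–§2 and
Thm IV.3: Stiefel–Whitney numbers are additive bordism invariants). [cite: ThomCMH1954, Ch. IV §2 (p. 65) and Thm IV.3] -/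
theorem UnorientedBordismClass.thomInvariant_add (a b : UnorientedBordismClass.{u} 4) :
    haveI := ClosedSingularManifold.bordismFacts_succ (Y := PUnit.{u + 1}) (n := 3)
    UnorientedBordismClass.thomInvariant (a + b) =
      UnorientedBordismClass.thomInvariant a + UnorientedBordismClass.thomInvariant b := by
  haveI := ClosedSingularManifold.bordismFacts_succ (Y := PUnit.{u + 1}) (n := 3)
  exact Prod.ext (UnorientedBordismClass.eulerCharModTwo_add a b)
    (UnorientedBordismClass.wuNumberOnePowFour_add a b)

/-! ### §2 Injectivity of an additive map on `𝔑₄` is triviality of its kernel -/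

/-- **`thomInvariant` is injective iff its kernel is trivial** (`𝔑₄` is an elementary abelian
2-group: `a = b ↔ a + b = 0`). [cite: ThomCMH1954, Thm IV.10 and Cor. IV.11 (p. 77)] -/
theorem UnorientedBordismClass.injective_thomInvariant_iff :
    Function.Injective (UnorientedBordismClass.thomInvariant : UnorientedBordismClass.{u} 4 → _) ↔
      ∀ a : UnorientedBordismClass.{u} 4, UnorientedBordismClass.thomInvariant a = 0 → a = 0 := by
  haveI := ClosedSingularManifold.bordismFacts_succ (Y := PUnit.{u + 1}) (n := 3)
  refine ⟨fun h a ha => h (ha.trans UnorientedBordismClass.thomInvariant_zero.symm), fun h a b hab => ?_⟩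
  have hab0 : UnorientedBordismClass.thomInvariant (a + b) = 0 := by
    rw [UnorientedBordismClass.thomInvariant_add, hab, ← UnorientedBordismClass.thomInvariant_add,
      BordismClass.add_self_eq_zero, UnorientedBordismClass.thomInvariant_zero]
    rfl
  have h0 := h (a + b) hab0
  calc a = a + (b + b) := by rw [BordismClass.add_self_eq_zero, BordismClass.add_zero]
    _ = a + b + b := by rw [BordismClass.add_assoc]
    _ = b := by rw [h0, BordismClass.zero_add]

/-- **`[M] = [(M, const)]`**: the class in `𝔑ₙ` of the carrier of a closed singular manifold over
the point is the class of that singular manifold (they differ only in the presentation of the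
constant structure map; the cylinder is a bordism). [cite: MilnorStasheff1974, §17] -/
theorem UnorientedBordismClass.mk_carrier {n : ℕ} (s : ClosedSingularManifold.{u} PUnit.{u + 1} n) :
    (UnorientedBordismClass.mk s.M : UnorientedBordismClass.{u} n) = BordismClass.mk s := by
  rw [UnorientedBordismClass.mk_eq]
  apply BordismClass.sound
  obtain ⟨c, F, -, -⟩ := ClosedSingularManifold.isBordant_self (ClosedSingularManifold.ofManifold n s.M)
  exact ⟨c, F, fun _ => Subsingleton.elim _ _, fun _ => Subsingleton.elim _ _⟩

/-! ### §3 `|𝔑₄| = 4` from Thom's Thm IV.10 at `k = 4` as printed -/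

/-- **`|𝔑₄| = 4` follows from Thom's Thm IV.10 at `k = 4`**: if *every closed smooth 4-manifold
`M` with `χ(M)` even and `v₁⁴[M] = 0` bounds mod 2* (`[M] = 0` in `𝔑₄`; Thom 1954, Thm IV.10
p. 77 — with `w₁ = v₁`, `w₄[M] = χ(M) mod 2` and the relations among the Stiefel–Whitney numbers of
4-manifolds these two numbers are all of them), then `Nat.card 𝔑₄ = 4`.  The hypothesis `hUB` is a
plain binder: it is the Pontryagin–Thom computation (Thm II.10 with Thm IV.8), not proved in the
tree; the rest — additivity of Thom's invariant, hence injectivity from the kernel, and the four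
pairwise distinct classes `0, [ℂℙ²], [ℝℙ⁴], [ℂℙ²] + [ℝℙ⁴]` — is proved.
[cite: ThomCMH1954, Thm IV.10 (p. 77), Thm IV.9 (p. 76), Thm IV.12 and pp. 79–80] -/
theorem natCard_unorientedBordismClass_four_of_forall_mk_eq_zero
    (hUB : ∀ (M : Type) [TopologicalSpace M] [T2Space M] [ChartedSpace (EuclideanSpace ℝ (Fin 4)) M]
      [IsManifold (𝓡 4) ∞ M] [CompactSpace M] [BoundarylessManifold (𝓡 4) M],
      UnorientedBordismClass.eulerCharModTwo (UnorientedBordismClass.mk M : UnorientedBordismClass.{0} 4) = 0 →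
        wuNumberOnePowFour M = 0 → (UnorientedBordismClass.mk M : UnorientedBordismClass.{0} 4) = 0) :
    natCard_unorientedBordismClass_four := by
  refine natCard_unorientedBordismClass_four_of_injective
    (UnorientedBordismClass.injective_thomInvariant_iff.2 fun a ha => ?_)
  induction a using BordismClass.ind with | h s => ?_
  rw [← UnorientedBordismClass.mk_carrier] at ha ⊢
  exact hUB s.M (congrArg Prod.fst ha)
    ((UnorientedBordismClass.wuNumberOnePowFour_mk' s.M).symm.trans (congrArg Prod.snd ha))

/-- Conversely the hypothesis of `natCard_unorientedBordismClass_four_of_forall_mk_eq_zero` follows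
from the injectivity of Thom's invariant, so that reduction loses nothing.
[cite: ThomCMH1954, Thm IV.10 and Cor. IV.11 (p. 77)] -/
theorem UnorientedBordismClass.mk_eq_zero_of_injective
    (h : Function.Injective (UnorientedBordismClass.thomInvariant : UnorientedBordismClass.{u} 4 → _))
    (M : Type u) [TopologicalSpace M] [T2Space M] [ChartedSpace (EuclideanSpace ℝ (Fin 4)) M]
    [IsManifold (𝓡 4) ∞ M] [CompactSpace M] [BoundarylessManifold (𝓡 4) M]
    (hχ : UnorientedBordismClass.eulerCharModTwo (UnorientedBordismClass.mk M : UnorientedBordismClass.{u} 4) = 0)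
    (hv : Literature.Topology.FourManifolds.wuNumberOnePowFour M = 0) :
    (UnorientedBordismClass.mk M : UnorientedBordismClass.{u} 4) = 0 :=
  UnorientedBordismClass.injective_thomInvariant_iff.1 h _
    (Prod.ext hχ ((UnorientedBordismClass.wuNumberOnePowFour_mk' M).trans hv))

/-! ### §4 `|𝔑₄| = 4` from Thm IV.13 (`Ω⁴`) and the orientability of the classes with `v₁⁴ = 0` -/

/-- **`|𝔑₄| = 4` from two inputs: Thom's Thm IV.13 and "`w₁⁴[M] = 0` ⟹ `M` is bordant mod 2 to an
orientable manifold".**  Given (1) the injectivity of `σ` on `Ω⁴` (the tree's open named fact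
`isOrientedBordant_of_signature_eq`, Thm IV.13, hypothesis `hX`) and (2) that every closed smooth
4-manifold with `v₁⁴[M] = 0` has the class of some closed `ℤ`-orientable smooth 4-manifold
(Thm IV.12 at `k = 4`: these classes are `0` and `[PC(2)]`; Wall 1960, the image of `Ω → 𝔑`;
hypothesis `hW`, a plain binder), Thm IV.10 at `k = 4` follows — an orientable class with `χ` even
is `0` by `UnorientedBordismClass.mk_eq_zero_of_eulerCharModTwo_eq_zero` — and with it
`Nat.card 𝔑₄ = 4`. [cite: ThomCMH1954, Thm IV.12 (pp. 79–80) and Thm IV.13 (p. 81)] [cite: Wall1960, Introduction] -/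
theorem natCard_unorientedBordismClass_four_of_thom_of_exists_orientable
    (hX : isOrientedBordant_of_signature_eq.{0})
    (hW : ∀ (M : Type) [TopologicalSpace M] [T2Space M] [ChartedSpace (EuclideanSpace ℝ (Fin 4)) M]
      [IsManifold (𝓡 4) ∞ M] [CompactSpace M] [BoundarylessManifold (𝓡 4) M],
      wuNumberOnePowFour M = 0 →
        ∃ (N : Type) (_ : TopologicalSpace N) (_ : T2Space N) (_ : SecondCountableTopology N)
          (_ : ChartedSpace (EuclideanSpace ℝ (Fin 4)) N) (_ : CompactSpace N) (_ : IsManifold (𝓡 4) ∞ N)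
          (_ : HomologicalOrientation ℤ N 4),
          (UnorientedBordismClass.mk M : UnorientedBordismClass.{0} 4) = UnorientedBordismClass.mk N) :
    natCard_unorientedBordismClass_four := by
  refine natCard_unorientedBordismClass_four_of_forall_mk_eq_zero fun M _ _ _ _ _ _ hχ hv => ?_
  obtain ⟨N, _, _, _, _, _, _, ν, hMN⟩ := hW M hv
  rw [hMN] at hχ ⊢
  exact UnorientedBordismClass.mk_eq_zero_of_eulerCharModTwo_eq_zero hX ν hχ

/-! ### §5 The reductions are lossless: `|𝔑₄| = 4 ↔ thomInvariant injective ↔ Thm IV.10 at k = 4` -/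

/-- **`|𝔑₄| = 4 ⟹ Thom's invariant is injective`**: if `𝔑₄` has exactly four elements then they
are the pairwise distinct classes `0, [ℂℙ²], [ℝℙ⁴], [ℂℙ²] + [ℝℙ⁴]` of the tree
(`four_le_natCard_unorientedBordismClass_four`), on which `(χ mod 2, v₁⁴)` has trivial kernel:
`(χ₂, v₁⁴)[ℂℙ²] = (1, 0)`, `v₁⁴[ℝℙ⁴] = 1`, `v₁⁴([ℂℙ²] + [ℝℙ⁴]) = 0 + 1` (Thom 1954, Thm IV.12
and pp. 79–80). [cite: ThomCMH1954, Thm IV.12 and pp. 79–80] -/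
theorem UnorientedBordismClass.injective_thomInvariant_of_natCard_eq_four
    (h : natCard_unorientedBordismClass_four) :
    Function.Injective (UnorientedBordismClass.thomInvariant : UnorientedBordismClass.{0} 4 → _) := by
  classical
  haveI := ClosedSingularManifold.bordismFacts_succ (Y := PUnit.{1}) (n := 3)
  unfold natCard_unorientedBordismClass_four at h
  haveI : Finite (UnorientedBordismClass.{0} 4) := Nat.finite_of_card_ne_zero (by omega)
  letI : Fintype (UnorientedBordismClass.{0} 4) := Fintype.ofFinite _
  refine UnorientedBordismClass.injective_thomInvariant_iff.2 fun a ha => ?_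
  set b : UnorientedBordismClass.{0} 4 := UnorientedBordismClass.mk ComplexProjectivePlane with hbdef
  set c : UnorientedBordismClass.{0} 4 := UnorientedBordismClass.mk (RealProjectiveSpace 4) with hcdef
  have hb0 : b ≠ 0 := unorientedBordismClass_mk_complexProjectivePlane_ne_zero_holds
  have hvb : UnorientedBordismClass.wuNumberOnePowFour b = 0 := by
    rw [hbdef, UnorientedBordismClass.wuNumberOnePowFour_mk']
    exact wuNumberOnePowFour_complexProjectivePlane
  have hvc : UnorientedBordismClass.wuNumberOnePowFour c = 1 :=
    UnorientedBordismClass.wuNumberOnePowFour_mk_realProjectiveSpace_four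
  have hv0 : UnorientedBordismClass.wuNumberOnePowFour (0 : UnorientedBordismClass.{0} 4) = 0 :=
    UnorientedBordismClass.wuNumberOnePowFour_zero
  have hvbc : UnorientedBordismClass.wuNumberOnePowFour (b + c) = 1 := by
    rw [UnorientedBordismClass.wuNumberOnePowFour_add, hvb, hvc, zero_add]
  -- the four classes are pairwise distinct, hence exhaust `𝔑₄`
  have h01 : (0 : UnorientedBordismClass.{0} 4) ≠ b := fun e => hb0 e.symm
  have h02 : (0 : UnorientedBordismClass.{0} 4) ≠ c := fun e => by
    rw [← e, hv0] at hvc; exact zero_ne_one hvc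
  have h03 : (0 : UnorientedBordismClass.{0} 4) ≠ b + c := fun e => by
    rw [← e, hv0] at hvbc; exact zero_ne_one hvbc
  have h12 : b ≠ c := fun e => by
    rw [e, hvc] at hvb; exact one_ne_zero hvb
  have h13 : b ≠ b + c := fun e => by
    rw [← e, hvb] at hvbc; exact zero_ne_one hvbc
  have h23 : c ≠ b + c := fun e => by
    apply hb0
    have h' : b + c + c = c + c := by rw [← e]
    rwa [BordismClass.add_assoc, BordismClass.add_self_eq_zero, BordismClass.add_zero] at h'
  have hs : ({0, b, c, b + c} : Finset (UnorientedBordismClass.{0} 4)).card = 4 := by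
    rw [Finset.card_insert_of_notMem (by simp [h01, h02, h03]),
      Finset.card_insert_of_notMem (by simp [h12, h13]),
      Finset.card_insert_of_notMem (by simp [h23]), Finset.card_singleton]
  have huniv : ({0, b, c, b + c} : Finset (UnorientedBordismClass.{0} 4)) = Finset.univ :=
    Finset.eq_univ_of_card _ (by rw [hs, ← Nat.card_eq_fintype_card, h])
  have hmem : a ∈ ({0, b, c, b + c} : Finset (UnorientedBordismClass.{0} 4)) :=
    huniv ▸ Finset.mem_univ a
  simp only [Finset.mem_insert, Finset.mem_singleton] at hmem
  -- on each of them a zero invariant forces the zero class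
  rcases hmem with rfl | rfl | rfl | rfl
  · rfl
  · exfalso
    have e := congrArg Prod.fst ha
    rw [hbdef, UnorientedBordismClass.thomInvariant_mk_complexProjectivePlane] at e
    exact one_ne_zero e
  · exfalso
    have e : UnorientedBordismClass.wuNumberOnePowFour c = 0 := congrArg Prod.snd ha
    rw [hvc] at e
    exact one_ne_zero e
  · exfalso
    have e : UnorientedBordismClass.wuNumberOnePowFour (b + c) = 0 := congrArg Prod.snd ha
    rw [hvbc] at e
    exact one_ne_zero e

/-- **`|𝔑₄| = 4 ↔ Thom's invariant `(χ mod 2, v₁⁴) : 𝔑₄ → (ℤ/2)²` is injective** — the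
tree's reduction `natCard_unorientedBordismClass_four_of_injective` loses nothing (Thom 1954,
Thm IV.12: `𝔑⁴ ≅ ℤ₂ + ℤ₂` via these two numbers). [cite: ThomCMH1954, Thm IV.9 (p. 76), Thm IV.12 and pp. 79–80] -/
theorem natCard_unorientedBordismClass_four_iff_injective_thomInvariant :
    natCard_unorientedBordismClass_four ↔
      Function.Injective (UnorientedBordismClass.thomInvariant : UnorientedBordismClass.{0} 4 → _) :=
  ⟨UnorientedBordismClass.injective_thomInvariant_of_natCard_eq_four,
    natCard_unorientedBordismClass_four_of_injective⟩

/-- **`|𝔑₄| = 4 ↔ Thom's Thm IV.10 at `k = 4`** (every closed smooth 4-manifold with `χ` even and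
`v₁⁴[M] = 0` bounds mod 2): the statement `natCard_unorientedBordismClass_four` and the printed
theorem it is reduced to are equivalent, so the census of this fact is exact.
[cite: ThomCMH1954, Thm IV.10 (p. 77), Thm IV.12 and pp. 79–80] -/
theorem natCard_unorientedBordismClass_four_iff_forall_mk_eq_zero :
    natCard_unorientedBordismClass_four ↔
      ∀ (M : Type) [TopologicalSpace M] [T2Space M] [ChartedSpace (EuclideanSpace ℝ (Fin 4)) M]
        [IsManifold (𝓡 4) ∞ M] [CompactSpace M] [BoundarylessManifold (𝓡 4) M],
        UnorientedBordismClass.eulerCharModTwo (UnorientedBordismClass.mk M : UnorientedBordismClass.{0} 4) = 0 →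
          wuNumberOnePowFour M = 0 → (UnorientedBordismClass.mk M : UnorientedBordismClass.{0} 4) = 0 :=
  ⟨fun h M _ _ _ _ _ _ hχ hv => UnorientedBordismClass.mk_eq_zero_of_injective
      (UnorientedBordismClass.injective_thomInvariant_of_natCard_eq_four h) M hχ hv,
    natCard_unorientedBordismClass_four_of_forall_mk_eq_zero⟩

end Literature.Topology.FourManifolds
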